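import Literature.MathematicalPhysics.QuantumFieldTheory.Balaban1983to89.B8Prop6CubeMemberGaugedReal
import Literature.MathematicalPhysics.QuantumFieldTheory.Balaban1983to89.B8Prop6CubeMemberFlatScalarBdry
import Literature.MathematicalPhysics.QuantumFieldTheory.Balaban1983to89.B8Prop6CubeMemberNormsFlatBdry4

/-!
# `Balaban1983to89.B8Prop6CubeMemberGaugedRealBdry` — [Balaban1985RegularSpaces] PROPOSITION 6 (p. 99) AT THE CUBE MEMBER OF (1.131): the knit's
# `p6` letter in the FLAT currency, REPAIRED — real inequality families + the flat four-line Prop.-3-frame socket + `H59D₁`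

statement-level skeleton of published theorems with citation tags; proofs where landed; nothing here is a claim about the
Yang–Mills mass gap

`[Balaban1985RegularSpaces]` CMP **99** (1985): Sect. F pp. 98–99 (Prop. 6, (1.131)–(1.138)), Thm 4 p. 88, Prop. 3 pp. 82/87, Prop. 5 pp. 93–94,
(1.92) p. 91, (1.98) p. 92, (1.101) p. 93, (1.58)–(1.59) p. 86; [4] = `[Balaban1985BackgroundPropagators]` Thms 3.1–3.3 pp. 397–399.

CITATION HEADER (lean-in-tree rule).  Cell `pub-ymgap` (D-0062), node N05 = [B8], seat `pub-ymgap-dag-n05-e` g7 (R141 (C) row s3b — the FLAT LINE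
for Proposition 6 in the repaired currency).  WHY: g4's `B8Prop6CubeMemberGaugedReal` (`gaugedBoundB8_cubeMember_real₃`, `prop6Printed_zdCub_real₃`, p494834)
is the knit-consumable `p6` letter of the flat line — `Node00.GaugedBoundB8` at every cube ∕ `B8.Prop6Printed` on `zdCub ∘ f` from, per cube: the
flat FIVE-line Prop.-3-frame socket, three REAL inequality families on explicit matrices, and Theorem 4's two-member clause `H59₁` — and the two
gauge-field inputs are certified UNSATISFIABLE at the finite cube in that un-repaired currency (g5: outer pure-gauge corner mode; the Hölder line is
moreover not `k`-uniform, dag-n06-b).  THIS FILE re-keys both theorems to the located repair R-d: ★★ `gaugedBoundB8_cubeMember_real_bdry`,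
★★ `prop6Printed_zdCub_real_bdry` — per cube: the flat FOUR-LINE Prop.-3-frame socket WITH the exterior-collar allowance (served by this
seat's `B8Prop6CubeMemberNormsFlatBdry4.norms136_cubeMember_flat_bdry_d4`), the three REAL families VERBATIM, and `H59D₁` (support clause + collar
allowance; served by `B8Prop6CubeMemberFlatScalarBdry.prop6_cubeMember_flat_of_real_bdry`); extra constants `0 ≤ B_∂`, `4B_∂ ≤ (dL − 1)B₀`;
SAME conclusions.  Proof: g4's §1 for the existence half + g6's window plumbing for the norm members + the g0 engine `gaugedBoundB8_of_clauses`;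
§2 g4's verbatim.  Kind «kernel-checked proof», theorems only, no `def`.

HONEST SCOPE.  Composition by name; nothing of [4] is proved (the real families, the flat four-line socket and `H59D₁` are displayed
HYPOTHESES, none certified false); the standing relation `3·2dL²·B_G·B_R ≤ B₀′` and the window `4B_∂ ≤ (dL − 1)B₀` are displayed; everything
else as in `B8Prop6CubeMemberGaugedReal` (HONEST SCOPE there).  Count-neutral; N05 NOT discharged; one finite `𝕋⁴` programme at fixed `ε`,
Bałaban as printed; nothing continuum ∕ ℝ⁴ ∕ OS ∕ mass-gap ∕ Clay.  No `sorry`, no `def`, no `instance`, no `notation`.  Unit `pub-ymgap-dag-n05-e`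
(g7), 2026-08-27.
-/

noncomputable section

open NormedSpace

namespace Literature.MathematicalPhysics.QuantumFieldTheory.Balaban1983to89.B8Prop6CubeMemberGaugedRealBdry

open scoped Matrix
open MatrixLog B7Prop1Explicit B7Prop2Explicit B7Prop1Local B7Eq92Concrete
open B7Prop3Flat (c3)
open B7Prop4GeneralLevels (logCovIter linCovIter)
open B8Ineq132 (covDerivFwd InAk BondTouches)
open B8Ineq133 (cutFixed)
open B8Lemma1NonAbelian (mulCfg)
open B8Eq115GaugeFixing (localGauge gaugeAct_mem_of)
open B8Eq119TwistedAxial (InAx Restr129)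
open B8Eq140Level (SideTouches)
open B8Eq143PlaqExpansion (pdiv)
open B8Eq146AExpansion (iEta plaqCovDeriv)
open B8Eq155JBound (Jcur wsup)
open B8ScaledSupNorm (bondNorm msup)
open B8Eq184Proof (gaugeExp cfgExp)
open B8Eq138LandauZd (IsLandau138W logCfg covLap)
open B8LambdaSpaceKLevel (wt)
open B8Eq131Cubes (tcube tLo tHi ctr)
open B8Eq131CubesAdmissible (cubeFam)
open B8CubeMemberZd (cubeLamS cubeLamB)
open B8Prop6OfThm4 (const_136 smallness_134)
open B8LeafModelZd (ZdIdx)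
open B8Prop6CubeMemberNormsAt (windows136_of_small)
open B8Prop6CubeMemberNormsFlatBdry4 (norms136_cubeMember_flat_bdry_d4)
open B8Prop6CubeMemberFlatScalarBdry (prop6_cubeMember_flat_of_real_bdry)
open B8Prop6CubeMemberGauged (gaugedBoundB8_of_clauses)
open Node00 (CubeB8 GaugedBoundB8 zdCub prop6Printed_zdCub_iff)
open Literature.MathematicalPhysics.QuantumLattice (blockMap)

export B7Prop1Explicit (Site)

variable {d : ℕ}

variable {𝔸 : Type} [CStarAlgebra 𝔸] [Nontrivial 𝔸]

/-! ## §1 `GaugedBoundB8` at every cube from the flat bodies in the repaired currency -/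

open Classical in
/-- ★★ **PROPOSITION 6 (p. 99), (1.135)–(1.138) AS `Node00.GaugedBoundB8` AT EVERY CUBE, FROM THE FLAT FOUR-LINE Prop.-3-FRAME SOCKET, THREE
REAL INEQUALITY FAMILIES AND `H59D₁` — ALL IN THE REPAIRED CURRENCY** — g4's `gaugedBoundB8_cubeMember_real₃` re-keyed: per cube `c`, (i) the
FOUR-LINE Prop.-3-frame b9 socket at background `1` with the exterior-collar allowance `+ B_∂·Φ₀(A′)` on each line (no Hölder line, no `∀ U₀`);
(ii) for every admissible `(U₀, α₀)`: nonnegative weights `w` and the three REAL families ((1.101), (1.92) + `Δ`-entry, (1.98)) on the explicit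
matrices at every truncation — VERBATIM; (iii) `H59D₁` — Theorem 4's two-member clause at background `1` with «`u = 1` off `□₀`» and the collar
allowance.  ONE threshold `c₁`; `0 ≤ B_∂`, `4B_∂ ≤ (dL − 1)B₀`.  CONCLUSION `GaugedBoundB8 L η U₀ c (7dL²(5dLB₀)Mα₀)` VERBATIM.
[cite: Balaban1985RegularSpaces, Prop. 6 (1.135)–(1.138) p.99, Thm 4 p.88, Prop. 3 p.87, Prop. 5 pp.93–94, (1.92) p.91, (1.98) p.92, (1.101) p.93, (1.58)–(1.59) p.86; Balaban1985BackgroundPropagators, Thms 3.1–3.3 pp.397–399] -/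
theorem gaugedBoundB8_cubeMember_real_bdry (hd2 : 2 ≤ d) {L : ℕ} (hL : 2 ≤ L) {B₀ B₀' C₂ cB9 B₀'H B₂' BG BR Bbd : ℝ} (hB₀ : 0 < B₀)
    (hB₀' : 0 < B₀') (hB : 2 ≤ 5 * (d : ℝ) * L * B₀) (hC₂ : 2097152 * ((d : ℝ) + 1) ^ 2 ≤ C₂) (hcB9 : 0 < cB9)
    (hB₀'H : 0 < B₀'H) (hB₂' : 0 ≤ B₂') (hBG : 0 ≤ BG) (hBR : 0 ≤ BR) (hfree : 3 * (2 * (d : ℝ) * (L : ℝ) ^ 2) * BG * BR ≤ B₀')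
    (hBbd : 0 ≤ Bbd) (hBd : 4 * Bbd ≤ ((d : ℝ) * L - 1) * B₀) :
    ∃ c₁ : ℝ, 0 < c₁ ∧ ∀ (η : ℝ), 0 < η → ∀ {K : ℕ} {Ω : ℕ → Set (Site d)} (c : CubeB8 d L K Ω),
      -- (1.59) for `G(1)`, `H(1)` IN THE REPAIRED CURRENCY: the FOUR-LINE Prop.-3-frame socket at background `1` on the cube, collar term on each line
      (∀ α₀' α₂ : ℝ, 0 < α₀' → α₀' ≤ cB9 → 0 < α₂ → α₂ ≤ cB9 →
        ∀ (W : Site d → Fin d → 𝔸ˣ), (∀ x κ, W x κ ∈ unitaryUnits 𝔸) →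
        InAk L c.k η α₀' (cubeFam false L c.a c.M c.ρ c.k) (1 : Site d → Fin d → 𝔸ˣ) → InAk L c.k η α₀' (cubeFam false L c.a c.M c.ρ c.k) (mulCfg W (1 : Site d → Fin d → 𝔸ˣ)) →
        IsLandau138W L c.k η (cubeFam false L c.a c.M c.ρ c.k 0) (cubeLamS L c.a c.M c.ρ c.k c.k) (1 : Site d → Fin d → 𝔸ˣ) W →
        ∀ A' : Site d → Fin d → 𝔸, (∀ y τ, IsSelfAdjoint (A' y τ)) →
        (∀ j, j ≤ c.k → ∀ (y : Site d) (τ : Fin d), SideTouches (cubeFam false L c.a c.M c.ρ c.k j) y τ →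
          W y τ = cfgExp η A' y τ ∧ ‖A' y τ‖ ≤ α₂ * ((L : ℝ) ^ j * η)⁻¹) →
        (∀ (y : Site d) (τ : Fin d), (∀ j, j ≤ c.k → ¬ SideTouches (cubeFam false L c.a c.M c.ρ c.k j) y τ) → A' y τ = 0) →
        msup L c.k η (-(1 : ℝ)) (fun j (b : Site d × Fin d) => SideTouches (cubeFam false L c.a c.M c.ρ c.k j) b.1 b.2) (fun b => A' b.1 b.2)
            ≤ B₀ * (bondNorm L c.k η (-(3 : ℝ)) (cubeFam false L c.a c.M c.ρ c.k) (fun x μ => Jcur η (1 : Site d → Fin d → 𝔸ˣ) A' μ x)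
              + wsup 1 (fun p : {p : ℕ × (Site d × Fin d) // p.1 ≤ c.k ∧ p.2 ∈ cubeLamB L c.a c.M c.ρ c.k c.k p.1} =>
                  linCovIter L (1 : Site d → Fin d → 𝔸ˣ) (iEta η A') p.1.1 p.1.2.1 p.1.2.2))
              + Bbd * msup L c.k η (-(1 : ℝ)) (fun j (b : Site d × Fin d) => j = 0 ∧ SideTouches (cubeFam false L c.a c.M c.ρ c.k 0) b.1 b.2 ∧
                  ¬ BondTouches (cubeFam false L c.a c.M c.ρ c.k 0) b.1 b.2) (fun b => A' b.1 b.2) ∧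
          msup L c.k η (-(2 : ℝ)) (fun j (t : Fin d × Fin d × Site d) => SideTouches (cubeFam false L c.a c.M c.ρ c.k j) t.2.2 t.2.1)
              (fun t => covDerivFwd η (1 : Site d → Fin d → 𝔸ˣ) t.1 (fun z => A' z t.2.1) t.2.2)
            ≤ B₀ * (bondNorm L c.k η (-(3 : ℝ)) (cubeFam false L c.a c.M c.ρ c.k) (fun x μ => Jcur η (1 : Site d → Fin d → 𝔸ˣ) A' μ x)
              + wsup 1 (fun p : {p : ℕ × (Site d × Fin d) // p.1 ≤ c.k ∧ p.2 ∈ cubeLamB L c.a c.M c.ρ c.k c.k p.1} =>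
                  linCovIter L (1 : Site d → Fin d → 𝔸ˣ) (iEta η A') p.1.1 p.1.2.1 p.1.2.2))
              + Bbd * msup L c.k η (-(1 : ℝ)) (fun j (b : Site d × Fin d) => j = 0 ∧ SideTouches (cubeFam false L c.a c.M c.ρ c.k 0) b.1 b.2 ∧
                  ¬ BondTouches (cubeFam false L c.a c.M c.ρ c.k 0) b.1 b.2) (fun b => A' b.1 b.2) ∧
          bondNorm L c.k η (-(3 : ℝ)) (cubeFam false L c.a c.M c.ρ c.k) (fun x μ => pdiv η (1 : Site d → Fin d → 𝔸ˣ) (plaqCovDeriv η (1 : Site d → Fin d → 𝔸ˣ) A') μ x)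
            ≤ B₀ * (bondNorm L c.k η (-(3 : ℝ)) (cubeFam false L c.a c.M c.ρ c.k) (fun x μ => Jcur η (1 : Site d → Fin d → 𝔸ˣ) A' μ x)
              + wsup 1 (fun p : {p : ℕ × (Site d × Fin d) // p.1 ≤ c.k ∧ p.2 ∈ cubeLamB L c.a c.M c.ρ c.k c.k p.1} =>
                  linCovIter L (1 : Site d → Fin d → 𝔸ˣ) (iEta η A') p.1.1 p.1.2.1 p.1.2.2))
              + Bbd * msup L c.k η (-(1 : ℝ)) (fun j (b : Site d × Fin d) => j = 0 ∧ SideTouches (cubeFam false L c.a c.M c.ρ c.k 0) b.1 b.2 ∧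
                  ¬ BondTouches (cubeFam false L c.a c.M c.ρ c.k 0) b.1 b.2) (fun b => A' b.1 b.2) ∧
          bondNorm L c.k η (-(3 : ℝ)) (cubeFam false L c.a c.M c.ρ c.k) (fun x μ => covLap η (1 : Site d → Fin d → 𝔸ˣ) (fun z => A' z μ) x)
            ≤ B₀ * (bondNorm L c.k η (-(3 : ℝ)) (cubeFam false L c.a c.M c.ρ c.k) (fun x μ => Jcur η (1 : Site d → Fin d → 𝔸ˣ) A' μ x)
              + wsup 1 (fun p : {p : ℕ × (Site d × Fin d) // p.1 ≤ c.k ∧ p.2 ∈ cubeLamB L c.a c.M c.ρ c.k c.k p.1} =>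
                  linCovIter L (1 : Site d → Fin d → 𝔸ˣ) (iEta η A') p.1.1 p.1.2.1 p.1.2.2))
              + Bbd * msup L c.k η (-(1 : ℝ)) (fun j (b : Site d × Fin d) => j = 0 ∧ SideTouches (cubeFam false L c.a c.M c.ρ c.k 0) b.1 b.2 ∧
                  ¬ BondTouches (cubeFam false L c.a c.M c.ρ c.k 0) b.1 b.2) (fun b => A' b.1 b.2)) →
      ∀ (U₀ : Site d → Fin d → 𝔸ˣ), (∀ x κ, U₀ x κ ∈ unitaryUnits 𝔸) → ∀ (α₀ : ℝ), 0 < α₀ → InAk L K η α₀ Ω U₀ →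
      7 * d * (L : ℝ) ^ 2 * c.M * α₀ ≤ c₁ →
      -- the weights of `Q′ᵀwQ′` and THE THREE REAL INEQUALITY FAMILIES on the explicit matrices at every truncation `n ≤ k`
      ∀ (w : ℕ → ℝ), (∀ j, 0 ≤ w j) →
      (∀ n, 1 ≤ n → n ≤ c.k → ∀ (S : Finset (Site d)), (∀ x, x ∈ S ↔ x ∈ cubeFam false L c.a c.M c.ρ c.k 0) →
        ∀ (B : Finset (ℕ × Site d)), (∀ p, p ∈ B ↔ p.1 ≤ n ∧ p.2 ∈ cubeLamS L c.a c.M c.ρ c.k n p.1) →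
        ∀ (K : Site d → Site d → ℝ), (∀ x z, K x z =
          ((η ^ 2)⁻¹ * ∑ μ : Fin d, ((2 : ℝ) * (if z = x then (1 : ℝ) else 0) - (if z = x + e μ then (1 : ℝ) else 0)
            - (if z = x - e μ then (1 : ℝ) else 0))) +
          (∑ j ∈ Finset.range (n + 1), (if blockMap (L ^ j) x ∈ cubeLamS L c.a c.M c.ρ c.k n j ∧ blockMap (L ^ j) z = blockMap (L ^ j) x then
            w j * ((((L : ℝ) ^ d)⁻¹) ^ j) ^ 2 else 0))) →
        ∀ (T : Matrix ↥S ↥S ℝ), T = Matrix.of (fun x z : ↥S => K x.1 z.1) →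
        ∀ (Q : Matrix ↥B ↥S ℝ), Q = Matrix.of (fun (p : ↥B) (z : ↥S) =>
          if blockMap (L ^ p.1.1) z.1 = p.1.2 then (((L : ℝ) ^ d)⁻¹) ^ p.1.1 else 0) →
        (∀ (ρ' : ↥S → ℝ) (r : ℝ), 0 ≤ r →
          (∀ j, j ≤ n → ∀ z : ↥S, z.1 ∈ cubeFam false L c.a c.M c.ρ c.k j → wt L η j ^ 2 * |ρ' z| ≤ r) →
          ∀ φ : Site d → ℝ, (∀ x, x ∉ cubeFam false L c.a c.M c.ρ c.k 0 → φ x = 0) → (∀ v : ↥S, φ v.1 = ∑ z : ↥S, T⁻¹ v z * ρ' z) →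
          (∀ x, |φ x| ≤ BG * r) ∧
          ∀ j, j ≤ n → ∀ p ∈ {b : Site d × Fin d | SideTouches (cubeFam false L c.a c.M c.ρ c.k j) b.1 b.2},
            wt L η j * |η⁻¹ * (φ (p.1 + e p.2) - φ p.1)| ≤ BG * r) ∧
        (∀ (X : ↥B → ℝ) (s : ℝ), 0 ≤ s → (∀ p', |X p'| ≤ s) →
          ∀ φ : Site d → ℝ, (∀ x, x ∉ cubeFam false L c.a c.M c.ρ c.k 0 → φ x = 0) →
          (∀ v : ↥S, φ v.1 = ∑ p' : ↥B, (T⁻¹ * (T⁻¹ * Qᵀ) * (Q * T⁻¹ * T⁻¹ * Qᵀ)⁻¹) v p' * X p') →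
          (∀ x, |φ x| ≤ B₀'H * s) ∧
          (∀ j, j ≤ n → ∀ p ∈ {b : Site d × Fin d | SideTouches (cubeFam false L c.a c.M c.ρ c.k j) b.1 b.2},
            wt L η j * |η⁻¹ * (φ (p.1 + e p.2) - φ p.1)| ≤ B₀'H * s) ∧
          (∀ j, j ≤ n → ∀ x ∈ cubeFam false L c.a c.M c.ρ c.k j,
            wt L η j ^ 2 * |∑ μ : Fin d, (η ^ 2)⁻¹ * (2 * φ x - φ (x + e μ) - φ (x - e μ))| ≤ B₂' * s)) ∧
        (∀ (ρ' : ↥S → ℝ) (r : ℝ), 0 ≤ r →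
          (∀ j, j ≤ n → ∀ z : ↥S, z.1 ∈ cubeFam false L c.a c.M c.ρ c.k j → wt L η j ^ 2 * |ρ' z| ≤ r) →
          ∀ j, j ≤ n → ∀ v : ↥S, v.1 ∈ cubeFam false L c.a c.M c.ρ c.k j →
            wt L η j ^ 2 * |ρ' v - ∑ z : ↥S, (T⁻¹ * (Qᵀ * ((Q * T⁻¹ * T⁻¹ * Qᵀ)⁻¹ * (Q * T⁻¹)))) v z * ρ' z| ≤ BR * r)) →
      -- (1.59) for `G(1)` IN THE REPAIRED CURRENCY: Theorem 4's two-member clause at background `1`, support clause + collar allowance (`H59D₁`)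
      ((∀ m, 1 ≤ m → m ≤ c.k → ∀ (u : Site d → 𝔸ˣ) (W : Site d → Fin d → 𝔸ˣ) (A' : Site d → Fin d → 𝔸),
        (∀ x, u x ∈ unitaryUnits 𝔸) → (∀ x, x ∉ (cubeFam false L c.a c.M c.ρ c.k) 0 → u x = 1) →
          mgauge (1 : Site d → Fin d → 𝔸ˣ) u W = (cutFixed L (tLo c.a c.ρ) (tHi c.a c.M c.ρ) U₀ c.k (ctr c.a c.M)) →
          Restr129 L m ((cubeLamS L c.a c.M c.ρ c.k) m) (1 : Site d → Fin d → 𝔸ˣ) u →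
          IsLandau138W L m η ((cubeFam false L c.a c.M c.ρ c.k) 0) ((cubeLamS L c.a c.M c.ρ c.k) m) (1 : Site d → Fin d → 𝔸ˣ) W →
        (∀ y τ, IsSelfAdjoint (A' y τ)) →
        (∀ j, j ≤ m → ∀ y τ, SideTouches ((cubeFam false L c.a c.M c.ρ c.k) j) y τ →
        W y τ = cfgExp η A' y τ ∧
          ‖A' y τ‖ ≤ (2 * (L * (5 * (d : ℝ) * L * B₀ * (((L : ℝ) ^ 3 * α₀) + (6 * d * (L : ℝ) ^ 2 * c.M * α₀)))) + 8 * (8 * B₀' * (5 * (d : ℝ) * L * B₀) * (((L : ℝ) ^ 3 * α₀) + (6 * d * (L : ℝ) ^ 2 * c.M * α₀)))) * ((L : ℝ) ^ j * η)⁻¹) →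
        (∀ y τ, (∀ j, j ≤ m → ¬ SideTouches ((cubeFam false L c.a c.M c.ρ c.k) j) y τ) → A' y τ = 0) →
        msup L m η (-(1 : ℝ)) (fun j (b : Site d × Fin d) => SideTouches ((cubeFam false L c.a c.M c.ρ c.k) j) b.1 b.2) (fun b => A' b.1 b.2)
        ≤ B₀ * (bondNorm L m η (-(3 : ℝ)) (cubeFam false L c.a c.M c.ρ c.k) (fun x μ => Jcur η (1 : Site d → Fin d → 𝔸ˣ) A' μ x)
        + wsup 1 (fun p : {p : ℕ × (Site d × Fin d) // p.1 ≤ m ∧ p.2 ∈ (cubeLamB L c.a c.M c.ρ c.k) m p.1} =>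
        linCovIter L (1 : Site d → Fin d → 𝔸ˣ) (iEta η A') p.1.1 p.1.2.1 p.1.2.2))
        + Bbd * msup L m η (-(1 : ℝ)) (fun j (b : Site d × Fin d) => j = 0 ∧ SideTouches ((cubeFam false L c.a c.M c.ρ c.k) 0) b.1 b.2 ∧
            ¬ BondTouches ((cubeFam false L c.a c.M c.ρ c.k) 0) b.1 b.2) (fun b => A' b.1 b.2) ∧
        msup L m η (-(2 : ℝ)) (fun j (t : Fin d × Fin d × Site d) => SideTouches ((cubeFam false L c.a c.M c.ρ c.k) j) t.2.2 t.2.1)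
        (fun t => covDerivFwd η (1 : Site d → Fin d → 𝔸ˣ) t.1 (fun z => A' z t.2.1) t.2.2)
        ≤ B₀ * (bondNorm L m η (-(3 : ℝ)) (cubeFam false L c.a c.M c.ρ c.k) (fun x μ => Jcur η (1 : Site d → Fin d → 𝔸ˣ) A' μ x)
        + wsup 1 (fun p : {p : ℕ × (Site d × Fin d) // p.1 ≤ m ∧ p.2 ∈ (cubeLamB L c.a c.M c.ρ c.k) m p.1} =>
        linCovIter L (1 : Site d → Fin d → 𝔸ˣ) (iEta η A') p.1.1 p.1.2.1 p.1.2.2))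
        + Bbd * msup L m η (-(1 : ℝ)) (fun j (b : Site d × Fin d) => j = 0 ∧ SideTouches ((cubeFam false L c.a c.M c.ρ c.k) 0) b.1 b.2 ∧
            ¬ BondTouches ((cubeFam false L c.a c.M c.ρ c.k) 0) b.1 b.2) (fun b => A' b.1 b.2))) →
      GaugedBoundB8 L η U₀ c (7 * d * (L : ℝ) ^ 2 * (5 * (d : ℝ) * L * B₀) * c.M * α₀) := by
  have hL1 : 1 ≤ L := le_trans (by norm_num) hL
  have hd1 : 1 ≤ d := le_trans (by norm_num) hd2
  have hLpos : (0 : ℝ) < L := by exact_mod_cast hL1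
  have hdpos : (0 : ℝ) < d := by exact_mod_cast hd1
  have hC₂0 : 0 ≤ C₂ := le_trans (by positivity) hC₂
  obtain ⟨c₄, hc₄, H4⟩ := prop6_cubeMember_flat_of_real_bdry (𝔸 := 𝔸) hd2 hL hB₀ hB₀' hB hB₀'H hB₂' hBG hBR hfree hBbd hBd
  obtain ⟨c₃, hc₃, N3⟩ := norms136_cubeMember_flat_bdry_d4 (𝔸 := 𝔸) hd2 hL hB₀ hC₂ hcB9 hBbd hBd
  obtain ⟨cW, hcW, W⟩ := windows136_of_small hd2 hL hB₀ hC₂0 hc₃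
  set B : ℝ := 5 * (d : ℝ) * L * B₀ with hB_def
  have hB0 : 0 < B := by positivity
  set C : ℝ := 131072 * ((d : ℝ) + 1) ^ 2 with hC_def
  have hC0 : 0 < C := by positivity
  refine ⟨min c₄ (min cW (1 / (16 * C * B))), lt_min hc₄ (lt_min hcW (by positivity)), ?_⟩
  intro η hη K Ω c SB9 U₀ hU₀ α₀ hα hAK hs w hw REAL H59
  -- the cube's laws as datum binders
  have hk : 1 ≤ c.k := c.one_le_k
  have hρL : L ≤ c.ρ := c.L_le_ρ
  have hρM : c.ρ ≤ c.M := c.ρ_le_M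
  have hρ : 1 ≤ c.ρ := hL1.trans hρL
  have hM1 : 1 ≤ c.M := hρ.trans hρM
  have hM : 11 * (d : ℝ) < c.M := by exact_mod_cast c.big
  have hLdM : (L : ℝ) ≤ d * c.M := by exact_mod_cast c.L_le_dM
  have hA : InAk L c.k η α₀ Ω U₀ := c.inAk hAK
  have hs₄ : 7 * d * (L : ℝ) ^ 2 * c.M * α₀ ≤ c₄ := hs.trans (min_le_left _ _)
  have hsW : 7 * d * (L : ℝ) ^ 2 * c.M * α₀ ≤ cW := hs.trans ((min_le_right _ _).trans (min_le_left _ _))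
  have hsC : 7 * d * (L : ℝ) ^ 2 * c.M * α₀ ≤ 1 / (16 * C * B) := hs.trans ((min_le_right _ _).trans (min_le_right _ _))
  -- every window from «7dL²Mα₀ ≤ c₁»
  obtain ⟨⟨hα3, hα2, hsmall⟩, ⟨hα₀c, hα₁c, hα₂c⟩, h61, ⟨-, -, h16, -, hc3α, hsmall₁⟩, h12⟩ := W c.M c.ρ hM1 hρM hM hLdM α₀ hα hsW
  -- PROPOSITION 6's existence half at the member FROM THE REAL FAMILIES + `H59D₁` (this seat's `B8Prop6CubeMemberFlatScalarBdry`)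
  obtain ⟨u, hu, huS, h129, hLan, h162, hw', h135⟩ := H4 η hη c.k hk c.a c.M c.ρ hρL hρM hM U₀ hU₀ α₀ hα hα3 hα2 Ω hA
    c.tcube_sub hsmall (smallness_134 hLpos hα hLdM hs₄) w hw REAL H59
  -- PROPOSITION 3's norm members at the member FROM THE FOUR-LINE FLAT SOCKET (this seat's `B8Prop6CubeMemberNormsFlatBdry4`)
  obtain ⟨h136g, h139j, h139l⟩ := N3 η hη c.k hk c.a c.M c.ρ hρL hρM hM SB9 U₀ hU₀ α₀ hα hα3 hα2 Ω hA c.tcube_sub hsmall hα₀c hα₂c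
    h61 hsmall₁ u hu huS h129 hLan h162
  -- the three norm members of (1.136), with print's constant (`const_136`)
  have hconst : B * ((L : ℝ) ^ 3 * α₀ + 6 * d * (L : ℝ) ^ 2 * c.M * α₀) ≤ 7 * d * (L : ℝ) ^ 2 * B * c.M * α₀ :=
    const_136 hLpos hα hB0.le hLdM
  have h136₂ := h136g.trans hconst
  have h136₃ := h139j.trans hconst
  have h136₄ := h139l.trans hconst
  have h16C : 16 * (131072 * ((d : ℝ) + 1) ^ 2) * (B * ((L : ℝ) ^ 3 * α₀ + 6 * d * (L : ℝ) ^ 2 * c.M * α₀)) ≤ 1 := by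
    have e1 : B * ((L : ℝ) ^ 3 * α₀ + 6 * d * (L : ℝ) ^ 2 * c.M * α₀) ≤ 7 * d * (L : ℝ) ^ 2 * B * c.M * α₀ := hconst
    have e3 : B * (7 * d * (L : ℝ) ^ 2 * c.M * α₀) ≤ B * (1 / (16 * C * B)) := mul_le_mul_of_nonneg_left hsC hB0.le
    have e4 : B * (1 / (16 * C * B)) = 1 / (16 * C) := by field_simp
    have e2 : 7 * d * (L : ℝ) ^ 2 * B * c.M * α₀ = B * (7 * d * (L : ℝ) ^ 2 * c.M * α₀) := by ring
    have e5 : B * ((L : ℝ) ^ 3 * α₀ + 6 * d * (L : ℝ) ^ 2 * c.M * α₀) ≤ 1 / (16 * C) := by linarith [e1, e3]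
    calc 16 * (131072 * ((d : ℝ) + 1) ^ 2) * (B * ((L : ℝ) ^ 3 * α₀ + 6 * d * (L : ℝ) ^ 2 * c.M * α₀))
        ≤ 16 * C * (1 / (16 * C)) := mul_le_mul_of_nonneg_left e5 (by positivity)
      _ = 1 := by field_simp
  exact gaugedBoundB8_of_clauses hd2 hL hB₀ hη c U₀ hU₀ hα hA hα3 hα2 hsmall h12 h16C hc3α u hu huS h129 hLan h162 hw' h135
    h136₂ h136₃ h136₄

#print axioms gaugedBoundB8_cubeMember_real_bdry

/-! ## §2 `B8.Prop6Printed` on `zdCub ∘ f` from the flat bodies in the repaired currency -/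

open Classical in
/-- ★★ **`B8.Prop6Printed d L (5dLB₀) c₁ (zdCub ∘ f)` FROM THE FLAT BODIES IN THE REPAIRED CURRENCY AT EVERY CUBE** — g4's
`prop6Printed_zdCub_real₃` re-keyed: per cube of every `f j`, the flat four-line Prop.-3-frame socket with collar allowance, and for every
admissible `(U₀, α₀)` SOME nonnegative weights with the three REAL inequality families at every truncation and `H59D₁`.  The knit's `p6` letter
of the flat line in a non-refuted currency. [cite: Balaban1985RegularSpaces, Prop. 6 p.99, Thm 4 p.88, Prop. 3 p.87, (1.92) p.91, (1.98) p.92, (1.101) p.93, (1.59) p.86] -/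
theorem prop6Printed_zdCub_real_bdry (hd2 : 2 ≤ d) {L : ℕ} (hL : 2 ≤ L) {B₀ B₀' C₂ cB9 B₀'H B₂' BG BR Bbd : ℝ} (hB₀ : 0 < B₀)
    (hB₀' : 0 < B₀') (hB : 2 ≤ 5 * (d : ℝ) * L * B₀) (hC₂ : 2097152 * ((d : ℝ) + 1) ^ 2 ≤ C₂) (hcB9 : 0 < cB9)
    (hB₀'H : 0 < B₀'H) (hB₂' : 0 ≤ B₂') (hBG : 0 ≤ BG) (hBR : 0 ≤ BR) (hfree : 3 * (2 * (d : ℝ) * (L : ℝ) ^ 2) * BG * BR ≤ B₀')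
    (hBbd : 0 ≤ Bbd) (hBd : 4 * Bbd ≤ ((d : ℝ) * L - 1) * B₀) :
    ∃ c₁ : ℝ, 0 < c₁ ∧ ∀ {ι : Type} (f : ι → ZdIdx d L),
      (∀ (i : ι) (c : CubeB8 d L (f i).k (f i).Ω),
      (∀ α₀' α₂ : ℝ, 0 < α₀' → α₀' ≤ cB9 → 0 < α₂ → α₂ ≤ cB9 →
        ∀ (W : Site d → Fin d → 𝔸ˣ), (∀ x κ, W x κ ∈ unitaryUnits 𝔸) →
        InAk L c.k (f i).η α₀' (cubeFam false L c.a c.M c.ρ c.k) (1 : Site d → Fin d → 𝔸ˣ) → InAk L c.k (f i).η α₀' (cubeFam false L c.a c.M c.ρ c.k) (mulCfg W (1 : Site d → Fin d → 𝔸ˣ)) →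
        IsLandau138W L c.k (f i).η (cubeFam false L c.a c.M c.ρ c.k 0) (cubeLamS L c.a c.M c.ρ c.k c.k) (1 : Site d → Fin d → 𝔸ˣ) W →
        ∀ A' : Site d → Fin d → 𝔸, (∀ y τ, IsSelfAdjoint (A' y τ)) →
        (∀ j, j ≤ c.k → ∀ (y : Site d) (τ : Fin d), SideTouches (cubeFam false L c.a c.M c.ρ c.k j) y τ →
          W y τ = cfgExp (f i).η A' y τ ∧ ‖A' y τ‖ ≤ α₂ * ((L : ℝ) ^ j * (f i).η)⁻¹) →
        (∀ (y : Site d) (τ : Fin d), (∀ j, j ≤ c.k → ¬ SideTouches (cubeFam false L c.a c.M c.ρ c.k j) y τ) → A' y τ = 0) →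
        msup L c.k (f i).η (-(1 : ℝ)) (fun j (b : Site d × Fin d) => SideTouches (cubeFam false L c.a c.M c.ρ c.k j) b.1 b.2) (fun b => A' b.1 b.2)
            ≤ B₀ * (bondNorm L c.k (f i).η (-(3 : ℝ)) (cubeFam false L c.a c.M c.ρ c.k) (fun x μ => Jcur (f i).η (1 : Site d → Fin d → 𝔸ˣ) A' μ x)
              + wsup 1 (fun p : {p : ℕ × (Site d × Fin d) // p.1 ≤ c.k ∧ p.2 ∈ cubeLamB L c.a c.M c.ρ c.k c.k p.1} =>
                  linCovIter L (1 : Site d → Fin d → 𝔸ˣ) (iEta (f i).η A') p.1.1 p.1.2.1 p.1.2.2))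
              + Bbd * msup L c.k (f i).η (-(1 : ℝ)) (fun j (b : Site d × Fin d) => j = 0 ∧ SideTouches (cubeFam false L c.a c.M c.ρ c.k 0) b.1 b.2 ∧
                  ¬ BondTouches (cubeFam false L c.a c.M c.ρ c.k 0) b.1 b.2) (fun b => A' b.1 b.2) ∧
          msup L c.k (f i).η (-(2 : ℝ)) (fun j (t : Fin d × Fin d × Site d) => SideTouches (cubeFam false L c.a c.M c.ρ c.k j) t.2.2 t.2.1)
              (fun t => covDerivFwd (f i).η (1 : Site d → Fin d → 𝔸ˣ) t.1 (fun z => A' z t.2.1) t.2.2)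
            ≤ B₀ * (bondNorm L c.k (f i).η (-(3 : ℝ)) (cubeFam false L c.a c.M c.ρ c.k) (fun x μ => Jcur (f i).η (1 : Site d → Fin d → 𝔸ˣ) A' μ x)
              + wsup 1 (fun p : {p : ℕ × (Site d × Fin d) // p.1 ≤ c.k ∧ p.2 ∈ cubeLamB L c.a c.M c.ρ c.k c.k p.1} =>
                  linCovIter L (1 : Site d → Fin d → 𝔸ˣ) (iEta (f i).η A') p.1.1 p.1.2.1 p.1.2.2))
              + Bbd * msup L c.k (f i).η (-(1 : ℝ)) (fun j (b : Site d × Fin d) => j = 0 ∧ SideTouches (cubeFam false L c.a c.M c.ρ c.k 0) b.1 b.2 ∧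
                  ¬ BondTouches (cubeFam false L c.a c.M c.ρ c.k 0) b.1 b.2) (fun b => A' b.1 b.2) ∧
          bondNorm L c.k (f i).η (-(3 : ℝ)) (cubeFam false L c.a c.M c.ρ c.k) (fun x μ => pdiv (f i).η (1 : Site d → Fin d → 𝔸ˣ) (plaqCovDeriv (f i).η (1 : Site d → Fin d → 𝔸ˣ) A') μ x)
            ≤ B₀ * (bondNorm L c.k (f i).η (-(3 : ℝ)) (cubeFam false L c.a c.M c.ρ c.k) (fun x μ => Jcur (f i).η (1 : Site d → Fin d → 𝔸ˣ) A' μ x)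
              + wsup 1 (fun p : {p : ℕ × (Site d × Fin d) // p.1 ≤ c.k ∧ p.2 ∈ cubeLamB L c.a c.M c.ρ c.k c.k p.1} =>
                  linCovIter L (1 : Site d → Fin d → 𝔸ˣ) (iEta (f i).η A') p.1.1 p.1.2.1 p.1.2.2))
              + Bbd * msup L c.k (f i).η (-(1 : ℝ)) (fun j (b : Site d × Fin d) => j = 0 ∧ SideTouches (cubeFam false L c.a c.M c.ρ c.k 0) b.1 b.2 ∧
                  ¬ BondTouches (cubeFam false L c.a c.M c.ρ c.k 0) b.1 b.2) (fun b => A' b.1 b.2) ∧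
          bondNorm L c.k (f i).η (-(3 : ℝ)) (cubeFam false L c.a c.M c.ρ c.k) (fun x μ => covLap (f i).η (1 : Site d → Fin d → 𝔸ˣ) (fun z => A' z μ) x)
            ≤ B₀ * (bondNorm L c.k (f i).η (-(3 : ℝ)) (cubeFam false L c.a c.M c.ρ c.k) (fun x μ => Jcur (f i).η (1 : Site d → Fin d → 𝔸ˣ) A' μ x)
              + wsup 1 (fun p : {p : ℕ × (Site d × Fin d) // p.1 ≤ c.k ∧ p.2 ∈ cubeLamB L c.a c.M c.ρ c.k c.k p.1} =>
                  linCovIter L (1 : Site d → Fin d → 𝔸ˣ) (iEta (f i).η A') p.1.1 p.1.2.1 p.1.2.2))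
              + Bbd * msup L c.k (f i).η (-(1 : ℝ)) (fun j (b : Site d × Fin d) => j = 0 ∧ SideTouches (cubeFam false L c.a c.M c.ρ c.k 0) b.1 b.2 ∧
                  ¬ BondTouches (cubeFam false L c.a c.M c.ρ c.k 0) b.1 b.2) (fun b => A' b.1 b.2)) ∧
      ∀ (U₀ : Site d → Fin d → 𝔸ˣ), (∀ x κ, U₀ x κ ∈ unitaryUnits 𝔸) → ∀ (α₀ : ℝ), 0 < α₀ → InAk L (f i).k (f i).η α₀ (f i).Ω U₀ →
      (∃ w : ℕ → ℝ, (∀ j, 0 ≤ w j) ∧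
      (∀ n, 1 ≤ n → n ≤ c.k → ∀ (S : Finset (Site d)), (∀ x, x ∈ S ↔ x ∈ cubeFam false L c.a c.M c.ρ c.k 0) →
        ∀ (B : Finset (ℕ × Site d)), (∀ p, p ∈ B ↔ p.1 ≤ n ∧ p.2 ∈ cubeLamS L c.a c.M c.ρ c.k n p.1) →
        ∀ (K : Site d → Site d → ℝ), (∀ x z, K x z =
          (((f i).η ^ 2)⁻¹ * ∑ μ : Fin d, ((2 : ℝ) * (if z = x then (1 : ℝ) else 0) - (if z = x + e μ then (1 : ℝ) else 0)
            - (if z = x - e μ then (1 : ℝ) else 0))) +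
          (∑ j ∈ Finset.range (n + 1), (if blockMap (L ^ j) x ∈ cubeLamS L c.a c.M c.ρ c.k n j ∧ blockMap (L ^ j) z = blockMap (L ^ j) x then
            w j * ((((L : ℝ) ^ d)⁻¹) ^ j) ^ 2 else 0))) →
        ∀ (T : Matrix ↥S ↥S ℝ), T = Matrix.of (fun x z : ↥S => K x.1 z.1) →
        ∀ (Q : Matrix ↥B ↥S ℝ), Q = Matrix.of (fun (p : ↥B) (z : ↥S) =>
          if blockMap (L ^ p.1.1) z.1 = p.1.2 then (((L : ℝ) ^ d)⁻¹) ^ p.1.1 else 0) →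
        (∀ (ρ' : ↥S → ℝ) (r : ℝ), 0 ≤ r →
          (∀ j, j ≤ n → ∀ z : ↥S, z.1 ∈ cubeFam false L c.a c.M c.ρ c.k j → wt L (f i).η j ^ 2 * |ρ' z| ≤ r) →
          ∀ φ : Site d → ℝ, (∀ x, x ∉ cubeFam false L c.a c.M c.ρ c.k 0 → φ x = 0) → (∀ v : ↥S, φ v.1 = ∑ z : ↥S, T⁻¹ v z * ρ' z) →
          (∀ x, |φ x| ≤ BG * r) ∧
          ∀ j, j ≤ n → ∀ p ∈ {b : Site d × Fin d | SideTouches (cubeFam false L c.a c.M c.ρ c.k j) b.1 b.2},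
            wt L (f i).η j * |((f i).η)⁻¹ * (φ (p.1 + e p.2) - φ p.1)| ≤ BG * r) ∧
        (∀ (X : ↥B → ℝ) (s : ℝ), 0 ≤ s → (∀ p', |X p'| ≤ s) →
          ∀ φ : Site d → ℝ, (∀ x, x ∉ cubeFam false L c.a c.M c.ρ c.k 0 → φ x = 0) →
          (∀ v : ↥S, φ v.1 = ∑ p' : ↥B, (T⁻¹ * (T⁻¹ * Qᵀ) * (Q * T⁻¹ * T⁻¹ * Qᵀ)⁻¹) v p' * X p') →
          (∀ x, |φ x| ≤ B₀'H * s) ∧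
          (∀ j, j ≤ n → ∀ p ∈ {b : Site d × Fin d | SideTouches (cubeFam false L c.a c.M c.ρ c.k j) b.1 b.2},
            wt L (f i).η j * |((f i).η)⁻¹ * (φ (p.1 + e p.2) - φ p.1)| ≤ B₀'H * s) ∧
          (∀ j, j ≤ n → ∀ x ∈ cubeFam false L c.a c.M c.ρ c.k j,
            wt L (f i).η j ^ 2 * |∑ μ : Fin d, ((f i).η ^ 2)⁻¹ * (2 * φ x - φ (x + e μ) - φ (x - e μ))| ≤ B₂' * s)) ∧
        (∀ (ρ' : ↥S → ℝ) (r : ℝ), 0 ≤ r →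
          (∀ j, j ≤ n → ∀ z : ↥S, z.1 ∈ cubeFam false L c.a c.M c.ρ c.k j → wt L (f i).η j ^ 2 * |ρ' z| ≤ r) →
          ∀ j, j ≤ n → ∀ v : ↥S, v.1 ∈ cubeFam false L c.a c.M c.ρ c.k j →
            wt L (f i).η j ^ 2 * |ρ' v - ∑ z : ↥S, (T⁻¹ * (Qᵀ * ((Q * T⁻¹ * T⁻¹ * Qᵀ)⁻¹ * (Q * T⁻¹)))) v z * ρ' z| ≤ BR * r))) ∧
      ((∀ m, 1 ≤ m → m ≤ c.k → ∀ (u : Site d → 𝔸ˣ) (W : Site d → Fin d → 𝔸ˣ) (A' : Site d → Fin d → 𝔸),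
        (∀ x, u x ∈ unitaryUnits 𝔸) → (∀ x, x ∉ (cubeFam false L c.a c.M c.ρ c.k) 0 → u x = 1) →
          mgauge (1 : Site d → Fin d → 𝔸ˣ) u W = (cutFixed L (tLo c.a c.ρ) (tHi c.a c.M c.ρ) U₀ c.k (ctr c.a c.M)) →
          Restr129 L m ((cubeLamS L c.a c.M c.ρ c.k) m) (1 : Site d → Fin d → 𝔸ˣ) u →
          IsLandau138W L m (f i).η ((cubeFam false L c.a c.M c.ρ c.k) 0) ((cubeLamS L c.a c.M c.ρ c.k) m) (1 : Site d → Fin d → 𝔸ˣ) W →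
        (∀ y τ, IsSelfAdjoint (A' y τ)) →
        (∀ j, j ≤ m → ∀ y τ, SideTouches ((cubeFam false L c.a c.M c.ρ c.k) j) y τ →
        W y τ = cfgExp (f i).η A' y τ ∧
          ‖A' y τ‖ ≤ (2 * (L * (5 * (d : ℝ) * L * B₀ * (((L : ℝ) ^ 3 * α₀) + (6 * d * (L : ℝ) ^ 2 * c.M * α₀)))) + 8 * (8 * B₀' * (5 * (d : ℝ) * L * B₀) * (((L : ℝ) ^ 3 * α₀) + (6 * d * (L : ℝ) ^ 2 * c.M * α₀)))) * ((L : ℝ) ^ j * (f i).η)⁻¹) →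
        (∀ y τ, (∀ j, j ≤ m → ¬ SideTouches ((cubeFam false L c.a c.M c.ρ c.k) j) y τ) → A' y τ = 0) →
        msup L m (f i).η (-(1 : ℝ)) (fun j (b : Site d × Fin d) => SideTouches ((cubeFam false L c.a c.M c.ρ c.k) j) b.1 b.2) (fun b => A' b.1 b.2)
        ≤ B₀ * (bondNorm L m (f i).η (-(3 : ℝ)) (cubeFam false L c.a c.M c.ρ c.k) (fun x μ => Jcur (f i).η (1 : Site d → Fin d → 𝔸ˣ) A' μ x)
        + wsup 1 (fun p : {p : ℕ × (Site d × Fin d) // p.1 ≤ m ∧ p.2 ∈ (cubeLamB L c.a c.M c.ρ c.k) m p.1} =>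
        linCovIter L (1 : Site d → Fin d → 𝔸ˣ) (iEta (f i).η A') p.1.1 p.1.2.1 p.1.2.2))
        + Bbd * msup L m (f i).η (-(1 : ℝ)) (fun j (b : Site d × Fin d) => j = 0 ∧ SideTouches ((cubeFam false L c.a c.M c.ρ c.k) 0) b.1 b.2 ∧
            ¬ BondTouches ((cubeFam false L c.a c.M c.ρ c.k) 0) b.1 b.2) (fun b => A' b.1 b.2) ∧
        msup L m (f i).η (-(2 : ℝ)) (fun j (t : Fin d × Fin d × Site d) => SideTouches ((cubeFam false L c.a c.M c.ρ c.k) j) t.2.2 t.2.1)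
        (fun t => covDerivFwd (f i).η (1 : Site d → Fin d → 𝔸ˣ) t.1 (fun z => A' z t.2.1) t.2.2)
        ≤ B₀ * (bondNorm L m (f i).η (-(3 : ℝ)) (cubeFam false L c.a c.M c.ρ c.k) (fun x μ => Jcur (f i).η (1 : Site d → Fin d → 𝔸ˣ) A' μ x)
        + wsup 1 (fun p : {p : ℕ × (Site d × Fin d) // p.1 ≤ m ∧ p.2 ∈ (cubeLamB L c.a c.M c.ρ c.k) m p.1} =>
        linCovIter L (1 : Site d → Fin d → 𝔸ˣ) (iEta (f i).η A') p.1.1 p.1.2.1 p.1.2.2))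
        + Bbd * msup L m (f i).η (-(1 : ℝ)) (fun j (b : Site d × Fin d) => j = 0 ∧ SideTouches ((cubeFam false L c.a c.M c.ρ c.k) 0) b.1 b.2 ∧
            ¬ BondTouches ((cubeFam false L c.a c.M c.ρ c.k) 0) b.1 b.2) (fun b => A' b.1 b.2)))) →
      B8.Prop6Printed d (L : ℝ) (5 * (d : ℝ) * L * B₀) c₁ (fun j => zdCub 𝔸 L (f j)) := by
  obtain ⟨c₁, hc₁, G⟩ := gaugedBoundB8_cubeMember_real_bdry (𝔸 := 𝔸) hd2 hL hB₀ hB₀' hB hC₂ hcB9 hB₀'H hB₂' hBG hBR hfree hBbd hBd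
  refine ⟨c₁, hc₁, fun f S => ?_⟩
  rw [prop6Printed_zdCub_iff]
  intro j α₀ hα U₀ hInA c hs
  obtain ⟨S₉, ST⟩ := S j c
  obtain ⟨⟨w, hw, REAL⟩, H59⟩ := ST U₀.1 U₀.2 α₀ hα hInA
  exact G (f j).η (f j).hη c S₉ U₀.1 U₀.2 α₀ hα hInA hs w hw REAL H59

#print axioms prop6Printed_zdCub_real_bdry

end Literature.MathematicalPhysics.QuantumFieldTheory.Balaban1983to89.B8Prop6CubeMemberGaugedRealBdry

end
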